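import Summits.Ventures.PercRepro.C041ConeClassF

/-!
# ROW C-041 — THE TWO-EXIT BLOCK MAP, THE TRIANGLE AND CYCLE DICTIONARIES AND THEIR CONSEQUENCES: the summary
(p6, gen 31)

Every end theorem of the gen restated with all its hypotheses in the type, for the referees' tree read:

* `row_C041_two_exit_block_map` — THEOREM (TWO-EXIT BLOCK MAP) (`C041TwoExitMain`);
* `row_C041_triangle_dict` — THE TRIANGLE DICTIONARY (`C041TriangleDict`);
* `row_C041_cycle_dict` — THE CYCLE DICTIONARY (`C041CycleDict`);
* `row_C041_triangle_rel_oCube` — THEOREM (RELAXED TRIANGLE) in zone form (`C041TriangleZone`);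
* `row_C041_cycle_cone_oCube` — the ZONE O-CUBE on every two-exit cycle with cone inputs (`C041CycleZone`);
* `row_C041_triangle_point_oCube`, `row_C041_cycle_point_oCube` — THE TRIANGLE / EVERY CYCLE WITH TWO MARKED
  VERTICES OF ANY MARKS satisfies the ZONE O-CUBE, no hypothesis;
* `row_C041_IsZf_oCube` — the ZONE O-CUBE on the class with marked cycles (`C041ConeClassF`).
-/

namespace PercRepro

namespace ZoneZ

open ZoneData TreeClosure RelaxedTriangle TwoExit PointZone

/-- **THEOREM (TWO-EXIT BLOCK MAP)**: the six-vector of an unmarked multigraph `Z₁` with the zones `Z`, `Z'`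
hung at its vertices `u`, `u'`, at its anchor `a₁`, is the sum over the colourings of `Z₁` of the contribution of
the statuses of the two exits. -/
theorem row_C041_two_exit_block_map {V₁ E₁ U₁ U₂ V E T₁ T₂ V' E' T₁' T₂' : Type} (Z₁ : ZoneData V₁ E₁ U₁ U₂)
    (u u' : V₁) (Z : ZoneData V E T₁ T₂) (a : V) (Z' : ZoneData V' E' T₁' T₂') (a' : V') (a₁ : V₁)
    [Fintype E₁] [DecidableEq E₁] [Fintype E] [DecidableEq E] [Fintype T₁] [DecidableEq T₁] [Fintype T₂]
    [DecidableEq T₂] [Fintype E'] [DecidableEq E'] [Fintype T₁'] [DecidableEq T₁'] [Fintype T₂']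
    [DecidableEq T₂'] :
    (glue2 Z₁ u u' Z a Z' a').sixVec (Sum.inl (Sum.inl a₁)) =
      ∑ ω : E₁ → Bool, contrib (Z.sixVec a) (Z'.sixVec a') (Z₁.Mg a₁ u ω) (Z₁.Rd a₁ u ω) (Z₁.Mg a₁ u' ω)
        (Z₁.Rd a₁ u' ω) (Z₁.Mg u u' ω) :=
  sixVec_glue2 Z₁ u u' Z a Z' a' a₁

/-- **THE TRIANGLE DICTIONARY**: the six-vector of the triangle `a – u – u' – a` with `Z` at `u` and `Z'` at
`u'` is mine-3's triangle map `thetaTri` of the two six-vectors. -/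
theorem row_C041_triangle_dict {V E T₁ T₂ V' E' T₁' T₂' : Type} (Z : ZoneData V E T₁ T₂) (a : V)
    (Z' : ZoneData V' E' T₁' T₂') (a' : V') [Fintype E] [DecidableEq E] [Fintype T₁] [DecidableEq T₁]
    [Fintype T₂] [DecidableEq T₂] [Fintype E'] [DecidableEq E'] [Fintype T₁'] [DecidableEq T₁'] [Fintype T₂']
    [DecidableEq T₂'] :
    (tri2 Z a Z' a').sixVec (Sum.inl (Sum.inl 0)) = thetaTri (Z.sixVec a) (Z'.sixVec a') :=
  sixVec_tri2 Z a Z' a'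

/-- **THE CYCLE DICTIONARY**: the six-vector of the cycle `C_{n+1}` through the anchor `0` with `Z` at `x_i` and
`Z'` at `x_j` (`0 < i < j`) is mine-3's arc-type model `thetaCyc` with the multiplicities `2^ℓ − 2` of the arcs
`[0, i)`, `[i, j)`, `[j, n]`. -/
theorem row_C041_cycle_dict (n : ℕ) (i j : Fin (n + 1)) (hi : 0 < i.val) (hij : i.val < j.val)
    {V E T₁ T₂ V' E' T₁' T₂' : Type} (Z : ZoneData V E T₁ T₂) (a : V) (Z' : ZoneData V' E' T₁' T₂') (a' : V')
    [Fintype E] [DecidableEq E] [Fintype T₁] [DecidableEq T₁] [Fintype T₂] [DecidableEq T₂] [Fintype E']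
    [DecidableEq E'] [Fintype T₁'] [DecidableEq T₁'] [Fintype T₂'] [DecidableEq T₂'] :
    (cyc2 n i j Z a Z' a').sixVec (Sum.inl (Sum.inl 0)) =
      thetaCyc ((2 : ℝ) ^ i.val - 2) ((2 : ℝ) ^ (j.val - i.val) - 2) ((2 : ℝ) ^ (n + 1 - j.val) - 2)
        (Z.sixVec a) (Z'.sixVec a') :=
  sixVec_cyc2 n i j Z a Z' a' hi hij

/-- **THEOREM (RELAXED TRIANGLE), zone form**: two zones in mine-3's relaxed domain at the exits of the triangle
give the ZONE O-CUBE on the triangle zone. -/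
theorem row_C041_triangle_rel_oCube {V E T₁ T₂ V' E' T₁' T₂' : Type} (Z : ZoneData V E T₁ T₂) (a : V)
    (Z' : ZoneData V' E' T₁' T₂') (a' : V') [Fintype E] [DecidableEq E] [Fintype T₁] [DecidableEq T₁]
    [Fintype T₂] [DecidableEq T₂] [Fintype E'] [DecidableEq E'] [Fintype T₁'] [DecidableEq T₁'] [Fintype T₂']
    [DecidableEq T₂'] (h : RelaxedTriangle.Rel (Z.sixVec a)) (h' : RelaxedTriangle.Rel (Z'.sixVec a')) :
    (tri2 Z a Z' a').ZoneOCubeConj {Sum.inl (Sum.inl 0)} (∅ : Set ((Fin 3 ⊕ V') ⊕ V)) :=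
  zoneOCubeConj_tri2_of_rel Z a Z' a' h h'

/-- **The ZONE O-CUBE on every two-exit cycle with two cone inputs.** -/
theorem row_C041_cycle_cone_oCube (n : ℕ) (i j : Fin (n + 1)) (hi : 0 < i.val) (hij : i.val < j.val)
    {V E T₁ T₂ V' E' T₁' T₂' : Type} (Z : ZoneData V E T₁ T₂) (a : V) (Z' : ZoneData V' E' T₁' T₂') (a' : V')
    [Fintype E] [DecidableEq E] [Fintype T₁] [DecidableEq T₁] [Fintype T₂] [DecidableEq T₂] [Fintype E']
    [DecidableEq E'] [Fintype T₁'] [DecidableEq T₁'] [Fintype T₂'] [DecidableEq T₂'] (h : InCone (Z.sixVec a))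
    (h' : InCone (Z'.sixVec a')) :
    (cyc2 n i j Z a Z' a').ZoneOCubeConj {Sum.inl (Sum.inl 0)} (∅ : Set ((Fin (n + 1) ⊕ V') ⊕ V)) :=
  zoneOCubeConj_cyc2_of_inCone n i j Z a Z' a' hi hij h h'

/-- **The triangle with two marked vertices of any marks satisfies the ZONE O-CUBE** (no hypothesis). -/
theorem row_C041_triangle_point_oCube (p q p' q' : ℕ) :
    (tri2 (pointZone p q) () (pointZone p' q') ()).ZoneOCubeConj {Sum.inl (Sum.inl 0)}
      (∅ : Set ((Fin 3 ⊕ Unit) ⊕ Unit)) :=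
  zoneOCubeConj_tri2_point p q p' q'

/-- **THEOREM (CYCLES WITH TWO MARKED VERTICES), on the graph model**: every cycle through the anchor with two
marked vertices of any marks satisfies the ZONE O-CUBE (no hypothesis). -/
theorem row_C041_cycle_point_oCube (n : ℕ) (i j : Fin (n + 1)) (hi : 0 < i.val) (hij : i.val < j.val)
    (p q p' q' : ℕ) :
    (cyc2 n i j (pointZone p q) () (pointZone p' q') ()).ZoneOCubeConj {Sum.inl (Sum.inl 0)}
      (∅ : Set ((Fin (n + 1) ⊕ Unit) ⊕ Unit)) :=
  zoneOCubeConj_cyc2_point n i j hi hij p q p' q'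

/-- **The ZONE O-CUBE on the class with marked cycles.** -/
theorem row_C041_IsZf_oCube {V E T₁ T₂ : Type} (Z : ZoneData V E T₁ T₂) (k : V) (h : IsZf Z k) [Fintype E]
    [DecidableEq E] [Fintype T₁] [DecidableEq T₁] [Fintype T₂] [DecidableEq T₂] :
    Z.ZoneOCubeConj {k} (∅ : Set V) :=
  h.zoneOCubeConj

end ZoneZ

end PercRepro
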